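import Mathlib

/-!
# The marker-merge chord of the gate functional fails on a 6-vertex, 7-edge graph at the uniform
`7/8` palette — kernel certificate (blind cell PercRepro2, seat engine g11, 2026-08-24; record D128)

Setting (row 2′CON-W / (CC-T⁻), `CCTLin.CCTMinus`; conventions of `GateChordPath.lean`): a finite
graph `H`, root `s`, avoided set `T = {t}`, markers `a, b`, a free edge `e = {u, w}` absent from `H`;
`S = C(s)`, `R_T = {S ∩ T = ∅}`, `x = 1[a ∈ S]`, `y = 1[b ∈ S]`, the gate `E = {s ↛ T in H + e}`, and
`Φ(H) := E[(x − x̄)(y − ȳ)·1_E | R_T]`, `x̄ = E[x | R_T]`.  For a root edge `e' = {s, z}` with `z` a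
MARKER, `Φ(H/e') = 0` (the marker is merged into the root), so the chord inequality reads
`Φ(H) ≥ (1 − p')·Φ(H − e')` with `p' = P(e' open | R_T)` — the MARKER-MERGE chord candidate (P3) of
NIGHT1-CHORD.md §2, refuted at `n = 7` (NEG-84) and, here, already at `n = 6`.

THE WITNESS: the cell's graph `c6_00030`, edges `{0,3}, {1,5}, {2,4}, {2,5}, {3,4}, {3,5}, {4,5}`, ALL
weights `7/8`; `s = 3`, `T = {1}`, `a = 2`, `b = 4`, free edge `{0, 5}`, root edge `e' = {3, 4} = {s, b}`.
Masses in units of `8^{-7}` (`2^7 = 128` configurations), `e'` open: `M₁ = 235256`, `E[x] = 228144`,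
`E[y] = 235256`, `E[1_E] = 230111`, `E[x1_E] = 225743`, `E[y1_E] = 230111`, `E[xy1_E] = 225743`;
`e'` closed: `M₀ = 61440`, `E[x] = 27832`, `E[y] = 27832`, `E[1_E] = 36352`, `E[x1_E] = 27832`,
`E[y1_E] = 27832`, `E[xy1_E] = 27440`.  Hence `p' = 29407/37087`, `Φ(H/e') = 0`,
`Φ(H − e') = 1115606471/7077888000`, `Φ(H) = 6630548465723/204044599270012`, and the chord defect
`Φ(H) − (1 − p')·Φ(H − e') = −6777610782097799/47011875671810764800 < 0`.
Masses by `decide` (kernel), inequalities by `norm_num`.  Two independent evaluators (the engine's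
`chord_twin.c` + `chord_eval.py` and a Python brute force) and the lead's re-check agree digit for digit.
-/

namespace Summit.Ventures.PercRepro2.GateChordSixVertex

/-- An undirected edge `{u, v}`, open with probability `w / 8`. -/
structure Edge where
  u : Nat
  v : Nat
  w : Nat

/-- The seven edges of `c6_00030` (vertices `0..5`), all of weight `7/8`. -/
def edge : Nat → Edge
  | 0 => ⟨0, 3, 7⟩   -- {0,3}  (u — s)
  | 1 => ⟨1, 5, 7⟩   -- {1,5}  (t — w)
  | 2 => ⟨2, 4, 7⟩   -- {2,4}  (a — b)
  | 3 => ⟨2, 5, 7⟩   -- {2,5}  (a — w)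
  | 4 => ⟨3, 4, 7⟩   -- {3,4}  (s — b: the marker root edge e')
  | 5 => ⟨3, 5, 7⟩   -- {3,5}  (s — w)
  | _ => ⟨4, 5, 7⟩   -- {4,5}  (b — w)

/-- The root `s = 3`. -/
def s : Nat := 3
/-- The avoided vertex `t = 1` (`T = {1}`). -/
def t : Nat := 1
/-- The marker `a = 2`. -/
def a : Nat := 2
/-- The marker `b = 4`. -/
def b : Nat := 4
/-- The free edge `e = {u, w} = {0, 5}`, absent from `H`. -/
def u : Nat := 0
/-- The other endpoint of the free edge. -/
def w : Nat := 5

/-- Edge `i` is open in the configuration `c ∈ [0, 2^7)` iff bit `i` of `c` is set. -/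
def isOpen (c i : Nat) : Bool := c.testBit i

/-- Product Bernoulli weight of the configuration `c`, in units of `8^{-7}`. -/
def wt (c : Nat) : Nat :=
  (List.range 7).foldl (fun acc i => acc * (if isOpen c i then (edge i).w else 8 - (edge i).w)) 1

/-- Vertex sets are bitmasks over `0..5`; `mem S x` is `x ∈ S`. -/
def mem (S x : Nat) : Bool := S.testBit x

/-- One expansion step of a vertex set along the open edges of `H` (undirected). -/
def step (c S : Nat) : Nat :=
  (List.range 7).foldl (fun S i =>
    let e := edge i
    if isOpen c i then
      if mem S e.u || mem S e.v then S ||| (1 <<< e.u) ||| (1 <<< e.v) else S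
    else S) S

/-- The same step in `H + e`: the free edge `{u, w}` is always open. -/
def stepPlus (c S : Nat) : Nat :=
  let S' := step c S
  if mem S' u || mem S' w then S' ||| (1 <<< u) ||| (1 <<< w) else S'

/-- `n`-fold iteration. -/
def iter (f : Nat → Nat) : Nat → Nat → Nat
  | 0, S => S
  | n + 1, S => iter f n (f S)

/-- `C(v)` in `H`: the open cluster of `v` (six steps suffice on six vertices). -/
def reach (c v : Nat) : Nat := iter (step c) 6 (1 <<< v)
/-- The open cluster of `v` in `H + e`. -/
def reachPlus (c v : Nat) : Nat := iter (stepPlus c) 6 (1 <<< v)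

/-- `R_T = {s ↛ t in H}`. -/
def RT (c : Nat) : Bool := !(mem (reach c s) t)
/-- The gate `E = {s ↛ t in H + e}` (`⊆ R_T`). -/
def E (c : Nat) : Bool := !(mem (reachPlus c s) t)
/-- `x = 1[a ∈ C(s)]`. -/
def x (c : Nat) : Bool := mem (reach c s) a
/-- `y = 1[b ∈ C(s)]`. -/
def y (c : Nat) : Bool := mem (reach c s) b
/-- The bit of the marker root edge `e' = {3, 4}` (edge index `4`). -/
def open1 (c : Nat) : Bool := isOpen c 4

/-- `8^7 · P(R_T ∩ {e' open} ∩ F)` for a predicate `F`. -/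
def mass1 (F : Nat → Bool) : Nat :=
  (List.range 128).foldl (fun acc c => if RT c && open1 c && F c then acc + wt c else acc) 0
/-- `8^7 · P(R_T ∩ {e' closed} ∩ F)`. -/
def mass0 (F : Nat → Bool) : Nat :=
  (List.range 128).foldl (fun acc c => if RT c && !open1 c && F c then acc + wt c else acc) 0

/-- Total mass `8^7` (sanity: the weights sum to one). -/
theorem total_mass : (List.range 128).foldl (fun acc c => acc + wt c) 0 = 8 ^ 7 := by decide +kernel

/-- The gate is a sub-event of `R_T` (sanity). -/
theorem gate_subset : ∀ c, c < 128 → E c = true → RT c = true := by decide +kernel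

/-- `e'` open merges the marker `b` into the root: `y = 1` on `R_T ∩ {e' open}` (sanity). -/
theorem open_merges_b : ∀ c, c < 128 → RT c = true → open1 c = true → y c = true := by decide +kernel

/-! ### The fourteen masses (kernel evaluation). -/

/-- `8^7 · P(R_T, e' open) = 235256`. -/
theorem M1_eq : mass1 (fun _ => true) = 235256 := by decide +kernel
/-- `8^7 · E[x; R_T, e' open] = 228144`. -/
theorem Mx1_eq : mass1 x = 228144 := by decide +kernel
/-- `8^7 · E[y; R_T, e' open] = 235256` (`= M₁`: the marker is merged). -/
theorem My1_eq : mass1 y = 235256 := by decide +kernel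
/-- `8^7 · P(E, e' open) = 230111`. -/
theorem Mr1_eq : mass1 E = 230111 := by decide +kernel
/-- `8^7 · E[x; E, e' open] = 225743`. -/
theorem Mxr1_eq : mass1 (fun c => x c && E c) = 225743 := by decide +kernel
/-- `8^7 · E[y; E, e' open] = 230111`. -/
theorem Myr1_eq : mass1 (fun c => y c && E c) = 230111 := by decide +kernel
/-- `8^7 · E[xy; E, e' open] = 225743`. -/
theorem Mxyr1_eq : mass1 (fun c => x c && y c && E c) = 225743 := by decide +kernel
/-- `8^7 · P(R_T, e' closed) = 61440`. -/
theorem M0_eq : mass0 (fun _ => true) = 61440 := by decide +kernel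
/-- `8^7 · E[x; R_T, e' closed] = 27832`. -/
theorem Mx0_eq : mass0 x = 27832 := by decide +kernel
/-- `8^7 · E[y; R_T, e' closed] = 27832`. -/
theorem My0_eq : mass0 y = 27832 := by decide +kernel
/-- `8^7 · P(E, e' closed) = 36352`. -/
theorem Mr0_eq : mass0 E = 36352 := by decide +kernel
/-- `8^7 · E[x; E, e' closed] = 27832`. -/
theorem Mxr0_eq : mass0 (fun c => x c && E c) = 27832 := by decide +kernel
/-- `8^7 · E[y; E, e' closed] = 27832`. -/
theorem Myr0_eq : mass0 (fun c => y c && E c) = 27832 := by decide +kernel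
/-- `8^7 · E[xy; E, e' closed] = 27440`. -/
theorem Mxyr0_eq : mass0 (fun c => x c && y c && E c) = 27440 := by decide +kernel

/-- The gate functional from the masses `(M, E[x], E[y], E[1_E], E[x1_E], E[y1_E], E[xy1_E])`
(all in the same units): `Φ = E[xy1_E]/M − x̄·E[y1_E]/M − ȳ·E[x1_E]/M + x̄ȳ·E[1_E]/M`. -/
def Phi (M Mx My Mr Mxr Myr Mxyr : ℚ) : ℚ :=
  Mxyr / M - (Mx / M) * (Myr / M) - (My / M) * (Mxr / M) + (Mx / M) * (My / M) * (Mr / M)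

/-- `Φ(H)` (the `(CC-T⁻)` slack divided by `P(R_T)`) on the witness, from the masses. -/
noncomputable def PhiH : ℚ :=
  Phi (mass1 (fun _ => true) + mass0 (fun _ => true)) (mass1 x + mass0 x) (mass1 y + mass0 y)
    (mass1 E + mass0 E) (mass1 (fun c => x c && E c) + mass0 (fun c => x c && E c))
    (mass1 (fun c => y c && E c) + mass0 (fun c => y c && E c))
    (mass1 (fun c => x c && y c && E c) + mass0 (fun c => x c && y c && E c))
/-- `Φ(H/e')` (the minor with `e'` open — the marker `b` merged into the root). -/
noncomputable def PhiOpen : ℚ :=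
  Phi (mass1 (fun _ => true)) (mass1 x) (mass1 y) (mass1 E) (mass1 (fun c => x c && E c))
    (mass1 (fun c => y c && E c)) (mass1 (fun c => x c && y c && E c))
/-- `Φ(H − e')` (the minor with `e'` closed). -/
noncomputable def PhiClosed : ℚ :=
  Phi (mass0 (fun _ => true)) (mass0 x) (mass0 y) (mass0 E) (mass0 (fun c => x c && E c))
    (mass0 (fun c => y c && E c)) (mass0 (fun c => x c && y c && E c))
/-- `p' = P(e' open | R_T)`. -/
noncomputable def pOpen : ℚ :=
  (mass1 (fun _ => true) : ℚ) / (mass1 (fun _ => true) + mass0 (fun _ => true))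

/-- The row `(CC-T⁻)` holds on the witness: `Φ(H) = 6630548465723/204044599270012 > 0`. -/
theorem PhiH_eq : PhiH = 6630548465723 / 204044599270012 := by
  unfold PhiH Phi
  rw [M1_eq, Mx1_eq, My1_eq, Mr1_eq, Mxr1_eq, Myr1_eq, Mxyr1_eq,
    M0_eq, Mx0_eq, My0_eq, Mr0_eq, Mxr0_eq, Myr0_eq, Mxyr0_eq]
  norm_num

/-- `Φ(H) > 0`. -/
theorem PhiH_pos : 0 < PhiH := by rw [PhiH_eq]; norm_num

/-- `Φ(H/e') = 0`: merging the marker `b` into the root makes `y ≡ 1`. -/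
theorem PhiOpen_eq : PhiOpen = 0 := by
  unfold PhiOpen Phi
  rw [M1_eq, Mx1_eq, My1_eq, Mr1_eq, Mxr1_eq, Myr1_eq, Mxyr1_eq]
  norm_num

/-- `Φ(H − e') = 1115606471/7077888000`. -/
theorem PhiClosed_eq : PhiClosed = 1115606471 / 7077888000 := by
  unfold PhiClosed Phi
  rw [M0_eq, Mx0_eq, My0_eq, Mr0_eq, Mxr0_eq, Myr0_eq, Mxyr0_eq]
  norm_num

/-- `p' = 29407/37087`. -/
theorem pOpen_eq : pOpen = 29407 / 37087 := by
  unfold pOpen; rw [M1_eq, M0_eq]; norm_num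

/-- **The marker-merge chord defect is negative**:
`Φ(H) − p'Φ(H/e') − (1−p')Φ(H − e') = −6777610782097799/47011875671810764800 < 0`. -/
theorem chord_defect_eq :
    PhiH - pOpen * PhiOpen - (1 - pOpen) * PhiClosed =
      -6777610782097799 / 47011875671810764800 := by
  rw [PhiH_eq, PhiOpen_eq, PhiClosed_eq, pOpen_eq]; norm_num

/-- The MARKER-MERGE chord inequality `Φ(H) ≥ (1 − p')·Φ(H − e')` FAILS at the root edge `{3, 4} = {s, b}`
of `c6_00030` at the uniform `7/8` palette: the candidate lemma (P3) of NIGHT1-CHORD.md §2 is false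
already on six vertices. -/
theorem marker_merge_chord_fails : PhiH < (1 - pOpen) * PhiClosed := by
  rw [PhiH_eq, PhiClosed_eq, pOpen_eq]; norm_num

end Summit.Ventures.PercRepro2.GateChordSixVertex
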